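import Summits.Ventures.GridStability.Lyapunov.WSCC9LossySlabData
import Summits.Ventures.GridStability.Lyapunov.WSCC9LurieObstructionTests
import Literature.MathematicalPhysics.PowerSystems.LuriePostnikovSlabCertificate
import HarnessLib

/-!
# GridStability/Lyapunov/WSCC9LossySlabCast — the printed-lossy WSCC9 object `WSCC9.lurieSystem` as casts of
# rational matrices, its affine input decomposition, and the KERNEL IDENTITIES with `N₀`, `N_j` (#35 lane V)

Venture GRIDFUSION, lead RULING R-LOSSY-SLAB-ROW + 07:15:04Z / 07:18:16Z (lane V PRIMARY); seat
gridfusion-lyap-1 (g4). Inputs: `WSCC9LossySlabData/Psd/VertData1–3/Vert1–2` (sos-2 Λ `2541e15e`,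
vertex pack `0d3f30ad`), lit-6's receptacle `LuriePostnikovSlabCertificate.lean` §5
(`SlabCertificate.ofVertices`, p507810) and §8 of `LossyMultimachineLurieForm.lean`
(`directedInput_eq_sum_of_injective`, `machineReference_B_eq_sum`), and lyap-1's definitional
unfoldings of the object (`Lyapunov/WSCC9LurieObstructionTests.lean`: `lurieSystem_A/_B/_C`, `tE`,
`tM`, `tD`, `Y.._bounds`).

WHAT IS PROVED. (1) STRUCTURE: `S.A`, `S.C` and the six unit-weight input matrices `B_j` of
`S = WSCC9.lurieSystem` are casts of rational matrices (`A_eq`, `C_eq`, `Bj_eq`); the true input is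
`S.B = 0 + Σ_j w_j • B_j` with the IRRATIONAL weights `w_j = E_pE_q·Y_pq` (`hB`), each inside the tree's
7-digit box (`hw`, from `Y.._bounds`). (2) THE KERNEL IDENTITIES: `−𝓛₀(S) = N₀` and `−𝓛_lin(B_j) = N_j`
(reindexed casts; `decide +kernel` over `ℚ`), hence for every vertex `v` the receptacle's vertex matrix IS
`(Mv v ↦ ℝ)` reindexed (`neg_slab_vertex_eq`) and is PSD by `WSCC9LossySlabVert1/2` (`hv`). (3) THE
CERTIFICATE `cert : SlabCertificate WSCC9.lurieSystem := SlabCertificate.ofVertices …` with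
`P − ε·1 ⪰ 0` from `WSCC9LossySlabPsd`, plus the rank-one facts in `S`-typed form (`rankOne`). The
sector hypothesis, the level and the sentence are `WSCC9LossySlabRoa.lean`.

THREE COLUMNS. CERTIFIED (kernel): the identities and the certificate's defining facts for the MODEL
`WSCC9.lurieSystem` = Pai's DIRECTED Lur'e form of M′ = WSCC9-postB-SPdamp-h12 (post-fault-B reduction
WITH transfer conductances, printed damping `D/M = 1/10, 1/5, 3/10`) — the very object of the #24
obstruction (`WSCC9LurieObstruction.lean`: the Popov-free quadratic class is EMPTY there). VALIDATED:
sos-2's solver lineages. MODELLED: as `Models/WSCC9.lean` / `ClassicalSwingLurie.lean` (MV-2 + MV-P +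
MV-SPD + MV-h12). No sentence of this file says a grid is stable.
-/

noncomputable section

open Matrix
open Literature.MathematicalPhysics.PowerSystems
open Literature.MathematicalPhysics.PowerSystems.LyapunovFunctionFamily
open Literature.Computation.Certificates
open Summit.Ventures.GridStability.Models
open Summit.Ventures.GridStability.Lyapunov.LurieObstruction

namespace Summit.Ventures.GridStability.Lyapunov.WSCC9LossySlab

/-! ### Index flattenings -/

/-- States `Fin 3 ⊕ Fin 2 ≃ Fin 5` (`ω₀, ω₁, ω₂, σ₁, σ₂`). -/
def e1 : Fin 3 ⊕ Fin 2 ≃ Fin 5 := finSumFinEquiv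

/-- Channels `Fin 3 × Fin 3 ≃ Fin 9`, `(p, q) ↦ 3p + q`. -/
def eκ : Fin 3 × Fin 3 ≃ Fin 9 := finProdFinEquiv

/-- Certificate-matrix index `(Fin 3 ⊕ Fin 2) ⊕ (Fin 3 × Fin 3) ≃ Fin 14`. -/
def e2 : (Fin 3 ⊕ Fin 2) ⊕ (Fin 3 × Fin 3) ≃ Fin 14 := (Equiv.sumCongr e1 eκ).trans finSumFinEquiv

/-! ### The object's matrices over `ℚ` -/

/-- `D_i/M_i` over `ℚ`. -/
def lamMQ (i : Fin 3) : ℚ := WSCC9.D_SP i / WSCC9.M i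

/-- `1/M_i` over `ℚ`. -/
def MinvQ (i : Fin 3) : ℚ := 1 / WSCC9.M i

/-- `A = [[−diag(D/M), 0], [refT, 0]]` over `ℚ`. -/
def AQ : Matrix (Fin 3 ⊕ Fin 2) (Fin 3 ⊕ Fin 2) ℚ :=
  Matrix.fromBlocks (-Matrix.diagonal lamMQ) 0
    (Matrix.of fun a i => (if i = a.succ then 1 else 0) - (if i = 0 then 1 else 0)) 0

/-- `C = [0 | pairIncidence]` over `ℚ`. -/
def CQ : Matrix (Fin 3 × Fin 3) (Fin 3 ⊕ Fin 2) ℚ :=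
  Matrix.fromCols 0 (Matrix.of fun k a => (if k.1 = a.succ then 1 else 0) - (if k.2 = a.succ then 1 else 0))

/-- The unit-weight input of active channel `kOf j` over `ℚ`: `1/M_p` at `(inl p, kOf j)`, `p = (kOf j).1`. -/
def BjQ (j : Fin 6) : Matrix (Fin 3 ⊕ Fin 2) (Fin 3 × Fin 3) ℚ :=
  Matrix.fromRows (Matrix.of fun i k => if k = kOf j then (if k.1 = i then MinvQ i else 0) else 0) 0

/-- `P` on the typed state index. -/
def PQ : Matrix (Fin 3 ⊕ Fin 2) (Fin 3 ⊕ Fin 2) ℚ := Pq.submatrix e1 e1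

/-- `τ` on the typed channel index. -/
def tauK (k : Fin 3 × Fin 3) : ℚ := tauQ (eκ k)
/-- `λ` on the typed channel index. -/
def lamK (k : Fin 3 × Fin 3) : ℚ := lamQ (eκ k)
/-- `a` on the typed channel index. -/
def aK (k : Fin 3 × Fin 3) : ℚ := aQ (eκ k)
/-- `b` on the typed channel index. -/
def bK (k : Fin 3 × Fin 3) : ℚ := bQ (eκ k)

/-- `𝓛₀` over `ℚ` (lit-6's `slabMatrix₀` formula on the rational data). -/
def slab0Q : Matrix ((Fin 3 ⊕ Fin 2) ⊕ (Fin 3 × Fin 3)) ((Fin 3 ⊕ Fin 2) ⊕ (Fin 3 × Fin 3)) ℚ :=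
  Matrix.fromBlocks
    (AQᵀ * PQ + PQ * AQ + etaQ • (1 : Matrix _ _ ℚ) - CQᵀ * Matrix.diagonal (fun k => tauK k * (aK k * bK k)) * CQ)
    ((CQ * AQ)ᵀ * Matrix.diagonal lamK + CQᵀ * Matrix.diagonal (fun k => tauK k * (aK k + bK k) / 2))
    ((CQ * AQ)ᵀ * Matrix.diagonal lamK + CQᵀ * Matrix.diagonal (fun k => tauK k * (aK k + bK k) / 2))ᵀ
    (-Matrix.diagonal tauK)

/-- `𝓛_lin(B)` over `ℚ` (lit-6's `slabMatrixLin` formula). -/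
def slabLinQ (B : Matrix (Fin 3 ⊕ Fin 2) (Fin 3 × Fin 3) ℚ) :
    Matrix ((Fin 3 ⊕ Fin 2) ⊕ (Fin 3 × Fin 3)) ((Fin 3 ⊕ Fin 2) ⊕ (Fin 3 × Fin 3)) ℚ :=
  Matrix.fromBlocks 0 (-(PQ * B)) (-(PQ * B))ᵀ
    (-(Matrix.diagonal lamK * (CQ * B)) - (Matrix.diagonal lamK * (CQ * B))ᵀ)

/-! ### The kernel identities with the literals `N₀`, `N_j` -/

set_option maxHeartbeats 400000 in
/-- **`−𝓛₀ = N₀`** (reindexed), decided over `ℚ` in the kernel. -/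
theorem N0_eq : -slab0Q = N0.submatrix e2 e2 := by
  decide +kernel

set_option maxHeartbeats 400000 in
/-- **`−𝓛_lin(B_j) = N_j`** (reindexed) for the six unit inputs, decided over `ℚ` in the kernel. -/
theorem Nj_eq : ∀ j : Fin 6, -slabLinQ (BjQ j) = (Nmat j).submatrix e2 e2 := by
  decide +kernel

/-- `𝓛_lin` over `ℚ` as a `ℚ`-linear map of the input matrix (plumbing). -/
def slabLinQₗ : Matrix (Fin 3 ⊕ Fin 2) (Fin 3 × Fin 3) ℚ →ₗ[ℚ]
    Matrix ((Fin 3 ⊕ Fin 2) ⊕ (Fin 3 × Fin 3)) ((Fin 3 ⊕ Fin 2) ⊕ (Fin 3 × Fin 3)) ℚ where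
  toFun := slabLinQ
  map_add' B₁ B₂ := by
    simp only [slabLinQ, Matrix.mul_add, neg_add, Matrix.transpose_add, Matrix.fromBlocks_add, add_zero]
    congr 1
    abel
  map_smul' c B := by
    simp only [slabLinQ, Matrix.mul_smul, RingHom.id_apply, Matrix.fromBlocks_smul, smul_zero, smul_neg,
      Matrix.transpose_smul, Matrix.transpose_neg, smul_sub]

/-- `𝓛_lin` of a weighted sum of inputs (linearity). -/
theorem slabLinQ_sum (c : Fin 6 → ℚ) :
    slabLinQ (∑ j, c j • BjQ j) = ∑ j, c j • slabLinQ (BjQ j) := by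
  have h : slabLinQ (∑ j, c j • BjQ j) = slabLinQₗ (∑ j, c j • BjQ j) := rfl
  rw [h, map_sum]
  simp only [map_smul]
  rfl

/-- **The vertex identity over `ℚ`**: `−(𝓛₀ + 𝓛_lin(Σ_j cv(v)_j • B_j)) = Mv v` (reindexed). -/
theorem negSlabQ_vertex_eq (v : Fin 6 → Bool) :
    -(slab0Q + slabLinQ (∑ j, cv v j • BjQ j)) = (Mv v).submatrix e2 e2 := by
  rw [slabLinQ_sum, neg_add, N0_eq, ← Finset.sum_neg_distrib]
  simp_rw [← smul_neg, Nj_eq]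
  ext i k
  simp [Mv, Matrix.sum_apply]

/-! ### The object `WSCC9.lurieSystem`: its matrices are the casts -/

/-- `toLitNode.M = M` (typed rationals). -/
private theorem tM' (i : Fin 3) : WSCC9.postB_SPdamp.toModel.toLitNode.M i = ((WSCC9.M i : ℚ) : ℝ) := by
  rw [ClassicalSwing.toLitNode_M]; rfl

/-- `S.A = AQ ↦ ℝ`. -/
theorem A_eq : WSCC9.lurieSystem.A = AQ.map (Rat.cast : ℚ → ℝ) := by
  rw [lurieSystem_A]
  ext a b
  rcases a with i | m <;> rcases b with i' | m'
  · by_cases h : i = i'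
    · subst h
      simp [Matrix.fromBlocks, AQ, Matrix.diagonal, tD, tM, lamMQ]
    · simp [Matrix.fromBlocks, AQ, Matrix.diagonal, h]
  · simp [Matrix.fromBlocks, AQ]
  · simp only [Matrix.fromBlocks_apply₂₁, InternalNode.refT, Matrix.of_apply, AQ, Matrix.map_apply]
    split_ifs <;> norm_num
  · simp [Matrix.fromBlocks, AQ]

/-- `S.C = CQ ↦ ℝ`. -/
theorem C_eq : WSCC9.lurieSystem.C = CQ.map (Rat.cast : ℚ → ℝ) := by
  rw [lurieSystem_C]
  ext k b
  rcases b with i | m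
  · simp [Matrix.fromCols, CQ]
  · simp only [Matrix.fromCols_apply_inr, InternalNode.pairIncidence, Matrix.of_apply, CQ, Matrix.map_apply]
    split_ifs <;> norm_num

/-- The unit-weight input matrix of active channel `kOf j` (lit-6's recipe: `[directedInput (1/M) fst e_k; 0]`). -/
def Bj (j : Fin 6) : Matrix (Fin 3 ⊕ Fin 2) (Fin 3 × Fin 3) ℝ :=
  Matrix.fromRows (System.directedInput (fun i => 1 / WSCC9.postB_SPdamp.toModel.toLitNode.M i) Prod.fst
    (Pi.single (kOf j) 1)) 0

/-- `B_j = BjQ j ↦ ℝ`. -/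
theorem Bj_eq (j : Fin 6) : Bj j = (BjQ j).map (Rat.cast : ℚ → ℝ) := by
  ext a k
  rcases a with i | m
  · simp only [Bj, BjQ, Matrix.fromRows_apply_inl, System.directedInput_single_apply, Matrix.map_apply,
      Matrix.of_apply, tM', MinvQ]
    by_cases h1 : k = kOf j
    · subst h1
      by_cases h2 : (kOf j).1 = i
      · simp [h2]
      · simp [h2]
    · simp [h1]
  · simp [Bj, BjQ]

/-- The true (irrational) weights of the active channels: `w_j = E_pE_q·Y_pq`, `(p, q) = kOf j`. -/
def w (j : Fin 6) : ℝ :=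
  WSCC9.postB_SPdamp.toModel.toLitNode.channelWeight WSCC9.postB_SPdamp.toModel.Ypol (kOf j)

/-- `kOf` is injective (decided). -/
theorem kOf_injective : Function.Injective kOf := by
  intro j j' h
  have : ∀ j j' : Fin 6, kOf j = kOf j' → j = j' := by decide
  exact this j j' h

/-- Off the range of `kOf` a channel is diagonal (decided), hence weightless. -/
theorem channelWeight_eq_zero_of_not_range (k : Fin 3 × Fin 3) (hk : k ∉ Set.range kOf) :
    WSCC9.postB_SPdamp.toModel.toLitNode.channelWeight WSCC9.postB_SPdamp.toModel.Ypol k = 0 := by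
  have hdiag : ∀ k : Fin 3 × Fin 3, k.1 ≠ k.2 → ∃ j, kOf j = k := by decide
  have h : k.1 = k.2 := by
    by_contra hne
    exact hk (hdiag k hne)
  simp [InternalNode.channelWeight, h]

/-- **`S.B = 0 + Σ_j w_j • B_j`** — the affine (here linear) parametrisation of the input by the six
active weights (lit-6 §8: `directedInput_eq_sum_of_injective` + `machineReference_B_eq_sum`). -/
theorem hB : WSCC9.lurieSystem.B = 0 + ∑ j, w j • Bj j := by
  have h := System.directedInput_eq_sum_of_injective
    (fun i => 1 / WSCC9.postB_SPdamp.toModel.toLitNode.M i) Prod.fst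
    (WSCC9.postB_SPdamp.toModel.toLitNode.channelWeight WSCC9.postB_SPdamp.toModel.Ypol) kOf kOf_injective
    channelWeight_eq_zero_of_not_range
  exact System.machineReference_B_eq_sum _ _ h _ _

/-- The node voltages as literals. -/
private theorem E0 : WSCC9.E 0 = 5283 / 5000 := rfl
/-- The node voltages as literals. -/
private theorem E1 : WSCC9.E 1 = 5251 / 5000 := rfl
/-- The node voltages as literals. -/
private theorem E2 : WSCC9.E 2 = 1017 / 1000 := rfl

/-- **Box membership of the true weights**: `lo_j ≤ w_j ≤ hi_j` from the tree's 7-digit enclosures of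
`Y_pq = √(B_pq² + G_pq²)` (`Y.._bounds`) times `E_pE_q > 0`. -/
theorem hw : ∀ j, ((loQ j : ℚ) : ℝ) ≤ w j ∧ w j ≤ ((hiQ j : ℚ) : ℝ) := by
  intro j
  fin_cases j
  · obtain ⟨h1, h2⟩ := Y01_bounds
    show ((loQ 0 : ℚ) : ℝ) ≤ w 0 ∧ w 0 ≤ ((hiQ 0 : ℚ) : ℝ)
    rw [show loQ 0 = 102545311046193 / 125000000000000 from rfl, show hiQ 0 = 205090649833419 / 250000000000000 from rfl]
    have hw' : w 0 = ((WSCC9.E 0 : ℚ) : ℝ) * ((WSCC9.E 1 : ℚ) : ℝ) * WSCC9.postB_SPdamp.toModel.Ypol 0 1 := by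
      simp [w, kOf, InternalNode.channelWeight, tE]
    rw [hw', E0, E1]
    norm_num at h1 h2 ⊢
    constructor <;> nlinarith
  · obtain ⟨h1, h2⟩ := Y02_bounds
    show ((loQ 1 : ℚ) : ℝ) ≤ w 1 ∧ w 1 ≤ ((hiQ 1 : ℚ) : ℝ)
    rw [show loQ 1 = 7361734294413 / 6250000000000 from rfl, show hiQ 1 = 11778775945623 / 10000000000000 from rfl]
    have hw' : w 1 = ((WSCC9.E 0 : ℚ) : ℝ) * ((WSCC9.E 2 : ℚ) : ℝ) * WSCC9.postB_SPdamp.toModel.Ypol 0 2 := by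
      simp [w, kOf, InternalNode.channelWeight, tE]
    rw [hw', E0, E2]
    norm_num at h1 h2 ⊢
    constructor <;> nlinarith
  · obtain ⟨h1, h2⟩ := Y10_bounds
    show ((loQ 2 : ℚ) : ℝ) ≤ w 2 ∧ w 2 ≤ ((hiQ 2 : ℚ) : ℝ)
    rw [show loQ 2 = 102545311046193 / 125000000000000 from rfl, show hiQ 2 = 205090649833419 / 250000000000000 from rfl]
    have hw' : w 2 = ((WSCC9.E 1 : ℚ) : ℝ) * ((WSCC9.E 0 : ℚ) : ℝ) * WSCC9.postB_SPdamp.toModel.Ypol 1 0 := by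
      simp [w, kOf, InternalNode.channelWeight, tE]
    rw [hw', E0, E1]
    norm_num at h1 h2 ⊢
    constructor <;> nlinarith
  · obtain ⟨h1, h2⟩ := Y12_bounds
    show ((loQ 3 : ℚ) : ℝ) ≤ w 3 ∧ w 3 ≤ ((hiQ 3 : ℚ) : ℝ)
    rw [show loQ 3 = 66501324960003 / 50000000000000 from rfl, show hiQ 3 = 6650133030027 / 5000000000000 from rfl]
    have hw' : w 3 = ((WSCC9.E 1 : ℚ) : ℝ) * ((WSCC9.E 2 : ℚ) : ℝ) * WSCC9.postB_SPdamp.toModel.Ypol 1 2 := by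
      simp [w, kOf, InternalNode.channelWeight, tE]
    rw [hw', E1, E2]
    norm_num at h1 h2 ⊢
    constructor <;> nlinarith
  · obtain ⟨h1, h2⟩ := Y20_bounds
    show ((loQ 4 : ℚ) : ℝ) ≤ w 4 ∧ w 4 ≤ ((hiQ 4 : ℚ) : ℝ)
    rw [show loQ 4 = 7361734294413 / 6250000000000 from rfl, show hiQ 4 = 11778775945623 / 10000000000000 from rfl]
    have hw' : w 4 = ((WSCC9.E 2 : ℚ) : ℝ) * ((WSCC9.E 0 : ℚ) : ℝ) * WSCC9.postB_SPdamp.toModel.Ypol 2 0 := by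
      simp [w, kOf, InternalNode.channelWeight, tE]
    rw [hw', E0, E2]
    norm_num at h1 h2 ⊢
    constructor <;> nlinarith
  · obtain ⟨h1, h2⟩ := Y21_bounds
    show ((loQ 5 : ℚ) : ℝ) ≤ w 5 ∧ w 5 ≤ ((hiQ 5 : ℚ) : ℝ)
    rw [show loQ 5 = 66501324960003 / 50000000000000 from rfl, show hiQ 5 = 6650133030027 / 5000000000000 from rfl]
    have hw' : w 5 = ((WSCC9.E 2 : ℚ) : ℝ) * ((WSCC9.E 1 : ℚ) : ℝ) * WSCC9.postB_SPdamp.toModel.Ypol 2 1 := by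
      simp [w, kOf, InternalNode.channelWeight, tE]
    rw [hw', E1, E2]
    norm_num at h1 h2 ⊢
    constructor <;> nlinarith

end Summit.Ventures.GridStability.Lyapunov.WSCC9LossySlab

end
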